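import Summits.BirchSwinnertonDyer.Rank1Residual.X11b.Three.KolyvaginNonvanishing
import HarnessLib

/-!
# TYPED STATEMENTS SZ14♭ and SZ14♯ at `p ≥ 5`, `p ∥ N` (cell `bsd-stepL`, seat `bsd-stepL-koly`; memos
# `koly/MEMO-v4.md` §5 and `koly/MEMO-v5.md`): Skinner–Zhang 2014 Thm 1.3 (the tree's unrefereed CLAIM
# `SkinnerZhang2014.thm1_3_exists_kolyvaginClass_one_ne_zero_OPEN`, `N⁻ = 1`) WITHOUT its split-`p` clause
# «`log_p q_E ∈ pℤ_p^×`» (♭), resp. with (c) and ♠(2) replaced by «`p ∤ ∏ c_ℓ`» (♯ — binders = the atom Locus)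

HONEST FRAMING: both are hypothesis-shaped `Prop`s per pair `(W, p)`; NOTHING asserts them; `@[conjecture]`; no census
word attaches until a referee verdict on MEMO-v4/MEMO-v5 and a planner ruling. The split-`p` clause of SZ14 Thm 1.3 (c)
is used in arXiv:1407.1099 ONLY to guarantee hypothesis (c) «`𝓛(𝒱) ≠ 0` if `a(p) = 1`» of its Thm 9.7 = Skinner, PJM 283
(2016) Thm B for the level-raised newforms (SZ14 p. 3 L14–15, p. 4 L32, §2.8, Thms 9.7/9.8/9.11, proof of Thm 10.1);
THEOREM B♭ of MEMO-v4 (uniform in `p ≥ 3`) proves the conclusion of Skinner's Thm B for `p`-new weight-2 forms with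
`a_p = 1` without it. ♠(2) («every multiplicative `ℓ ≠ p` ramified») is replaced by `p ∤ ∏ c_ℓ` by the lemmas W1–W3 of
`koly/Z3PRIME-W123.md` (uniform in odd `p`; MEMO-v5 §2), and «not finite at p» on NON-split rows is removed by
MEMO-v3.1/ADDENDUM-A1's architecture transported to `p ≥ 5` (MEMO-v5 §3); on split rows it follows from `p ∤ ∏ c_ℓ`.
The theorems below are bookkeeping (the claim ⇒ ♭ on the claim's locus; ♯ ⇒ the ♭-shaped statement given
`p ∤ ∏ c_ℓ`) and the two McCallum consumers (⇒ STEP L `X11b.IndexLowerBoundAt W p K y_K`), exactly as in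
`exists_indexLowerBoundAt_of_skinnerZhang2014_of_mccallum` (same directory, `KolyvaginNonvanishing.lean`).
-/

noncomputable section

open scoped Classical

namespace Summit.BirchSwinnertonDyer.Rank1Residual.X11b.Three.Koly

open WeierstrassCurve Literature.NumberTheory.EllipticCurves
  Literature.NumberTheory.EllipticCurves.ModularForms

/-- **SZ14♭ (typed; NOT asserted) — memo MEMO-v4 §5; no census word attaches until a referee verdict and a planner ruling.**
Skinner–Zhang 2014 Thm 1.3 at `N⁻ = 1` for the pair `(W, p)`, `p ≥ 5`, `p ∥ N`, with the split-`p`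
`𝓛`-clause REMOVED. Binders: `W` globally minimal; `5 ≤ p`; `p ∥ N` multiplicative; `ρ̄_{E,p}`
irreducible; `p ∤ v_p(Δ_min)` («not finite at p»); ♠(2): every multiplicative `ℓ ≠ p` has
`p ∤ v_ℓ(Δ_min)`; ♠(3) = Ram: one such `ℓ` exists; `K` imaginary quadratic, Heegner for `N_E`.
Conclusion verbatim that of the tree's transcription of SZ14 Thm 1.3. CONJECTURE-shaped `Prop` (nothing
asserted; cell bsd-stepL, seat koly; memo `koly/MEMO-v4.md` §5, THEOREM B♭).
[cite: SkinnerZhang2014, Thm. 1.3 (§1, p. 3) — shape, with clause (c)'s «log_p q_E ∈ pℤ_p^×» deleted; NOT printed in this form; nothing asserted] -/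
@[conjecture] def SkinnerZhangFlat (W : WeierstrassCurve ℚ) [W.IsElliptic] [W.IsGloballyMinimal]
    [NeZero (W.conductorNorm ℤ)] (p : ℕ) [hp : Fact p.Prime] (K : Type) [Field K] [NumberField K] :
    Prop :=
  5 ≤ p → W.HasMultiplicativeReductionAtPrime p →
  W.HasIrreducibleModPGaloisRep p →
  ¬ p ∣ padicValInt p W.minimalDiscriminantInt →
  (∀ (ℓ : ℕ) [Fact ℓ.Prime], ℓ ≠ p → W.HasMultiplicativeReductionAtPrime ℓ →
    ¬ p ∣ padicValInt ℓ W.minimalDiscriminantInt) →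
  (∃ (ℓ : ℕ) (_ : Fact ℓ.Prime), ℓ ≠ p ∧ W.HasMultiplicativeReductionAtPrime ℓ ∧
    ¬ p ∣ padicValInt ℓ W.minimalDiscriminantInt) →
  IsImaginaryQuadratic K → SatisfiesHeegnerHypothesis (W.conductorNorm ℤ) K →
  ∃ (Dt : ModularParametrizationData W (W.conductorNorm ℤ)) (β : ℤ) (ι : K →+* ℂ) (n : ℕ)
    (d : KolyvaginHeegnerData Dt β ι n),
    KolyvaginDescent.KolSupp (Zhang2014.IsKolyvaginPrime (W.conductorNorm ℤ) W K p) n ∧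
      (1 : ℕ∞) ≤ Zhang2014.levelIndex W p n ∧ d.kolyvaginClass hp.out 1 ≠ 0

/-- **The claim implies the flat statement on the claim's own locus** (bookkeeping only): given SZ14 Thm 1.3
as transcribed (`_OPEN`, with the `𝓛`-clause among its hypotheses) AND the `𝓛`-clause for this `W`, the flat
statement holds. Nothing asserted about either. [claim: SkinnerZhang2014, status: under-review] -/
theorem skinnerZhangFlat_of_OPEN_of_logClause (W : WeierstrassCurve ℚ) [W.IsElliptic]
    [W.IsGloballyMinimal] [NeZero (W.conductorNorm ℤ)] (p : ℕ) [hp : Fact p.Prime] (K : Type) [Field K]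
    [NumberField K] (hSZ : SkinnerZhang2014.thm1_3_exists_kolyvaginClass_one_ne_zero_OPEN)
    (hL : W.HasSplitMultiplicativeReductionAtPrime p →
      ∀ D : TateParameterData W p, (padicLog p D.q).valuation = 1) :
    SkinnerZhangFlat W p K :=
  fun hp5 hmult hirr hfin hram hRam hK hH ↦
    hSZ W p hp5 hmult hirr hfin hL (fun ℓ _ hne hm ↦ hram ℓ hne hm) hRam K hK hH

/-- **SZ14♭ ⇒ STEP L at `p ≥ 5`** (the `𝓛`-clause-free Kolyvagin road on N8): the same McCallum consumer as
`exists_indexLowerBoundAt_of_skinnerZhang2014_of_mccallum`, with `hL` no longer a binder. CONDITIONAL on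
`hMc`; `hSZb : SkinnerZhangFlat W p K` is a HYPOTHESIS (open; memo not yet refereed).
[cite: McCallumLMS1991, §5 Cor. 5.6 (p. 310)] -/
theorem exists_indexLowerBoundAt_of_skinnerZhangFlat_of_mccallum (W : WeierstrassCurve ℚ)
    [W.IsElliptic] [W.IsGloballyMinimal] [NeZero (W.conductorNorm ℤ)] (K : Type) [Field K]
    [NumberField K] (p : ℕ) [hp : Fact p.Prime] (hSZb : SkinnerZhangFlat W p K)
    (hMc : McCallum1991_pow_dvd_card_sha_primary_of_certificate)
    (hp5 : 5 ≤ p) (hmult : W.HasMultiplicativeReductionAtPrime p)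
    (hirr : W.HasIrreducibleModPGaloisRep p)
    (hfin : ¬ p ∣ padicValInt p W.minimalDiscriminantInt)
    (hram : ∀ (ℓ : ℕ) [Fact ℓ.Prime], ℓ ≠ p → W.HasMultiplicativeReductionAtPrime ℓ →
      ¬ p ∣ padicValInt ℓ W.minimalDiscriminantInt)
    (hRam : ∃ (ℓ : ℕ) (_ : Fact ℓ.Prime), ℓ ≠ p ∧ W.HasMultiplicativeReductionAtPrime ℓ ∧
      ¬ p ∣ padicValInt ℓ W.minimalDiscriminantInt)
    (hK : IsImaginaryQuadratic K) (hH : SatisfiesHeegnerHypothesis (W.conductorNorm ℤ) K)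
    (hCM : ¬ W.HasCM) (h3 : NumberField.discr K ≠ -3) (h4 : NumberField.discr K ≠ -4)
    (hsurj : ∀ m : ℕ, W.HasSurjectiveModNGaloisRep (p ^ m : ℕ))
    (hrank : (W.baseChange K).mordellWeilRank = 1)
    (hiv : ∀ x : (W.baseChange K).toAffine.Point, p • x = 0 → x = 0)
    [Finite (W.baseChange K).sha] :
    ∃ (Dt : ModularParametrizationData W (W.conductorNorm ℤ)) (β : ℤ) (ι : K →+* ℂ),
      ∀ (d₁ : KolyvaginHeegnerData Dt β ι 1) (P : (W.baseChange K).toAffine.Point),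
        d₁.toGeomPoints d₁.derivedPoint = toGeomPoints (W.baseChange K) P →
        ¬ IsOfFinAddOrder P →
        ∀ (M₀ : ℕ), (∃ Q : (W.baseChange K).toAffine.Point, ((p ^ M₀ : ℕ) : ℤ) • Q = P) →
          (¬ ∃ Q : (W.baseChange K).toAffine.Point, ((p ^ (M₀ + 1) : ℕ) : ℤ) • Q = P) →
          IndexLowerBoundAt W p K P := by
  obtain ⟨Dt, β, ι, n, d, hn, -, hne⟩ := hSZb hp5 hmult hirr hfin (fun ℓ _ hne hm ↦ hram ℓ hne hm) hRam hK hH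
  have hp2 : p ≠ 2 := by omega
  exact ⟨Dt, β, ι, fun d₁ P hP hPinf M₀ hdiv hndiv ↦
    indexLowerBoundAt_of_kolyvaginClass_one_ne_zero_of_mccallum W K hMc hCM hK h3 h4 hH p hp2 hsurj
      Dt β ι d₁ P hP hPinf hrank hiv hdiv hndiv d hn hne⟩


/-- **SZ14♯ (typed; NOT asserted) — memo MEMO-v5; no census word attaches until a referee verdict and a planner ruling.** Kolyvagin's conjecture
mod `p` for the pair `(W, p)` on N8's atom Locus: binders `5 ≤ p`; `p ∥ N` multiplicative (either sign); `ρ̄_{E,p}`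
irreducible; Ram: `∃ ℓ₀ ≠ p` multiplicative with `p ∤ v_{ℓ₀}(Δ_min)`; `p ∤ ∏ c_ℓ`; `K` imaginary quadratic, Heegner for
`N_E`. Conclusion verbatim that of the tree's transcription of SZ14 Thm 1.3 (`N⁻ = 1`). CONJECTURE-shaped `Prop` (nothing
asserted; cell bsd-stepL, seat koly; memo `koly/MEMO-v5.md`).
[cite: SkinnerZhang2014, Thm. 1.3 (§1, p. 3) — shape, with (c) and ♠(2) replaced by «p ∤ ∏ c_ℓ»; NOT printed in this form; nothing asserted] -/
@[conjecture] def SkinnerZhangSharp (W : WeierstrassCurve ℚ) [W.IsElliptic] [W.IsGloballyMinimal]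
    [NeZero (W.conductorNorm ℤ)] (p : ℕ) [hp : Fact p.Prime] (K : Type) [Field K] [NumberField K] :
    Prop :=
  5 ≤ p → W.HasMultiplicativeReductionAtPrime p →
  W.HasIrreducibleModPGaloisRep p →
  (∃ (ℓ : ℕ) (_ : Fact ℓ.Prime), ℓ ≠ p ∧ W.HasMultiplicativeReductionAtPrime ℓ ∧
    ¬ p ∣ padicValInt ℓ W.minimalDiscriminantInt) →
  ¬ p ∣ W.tamagawaProduct →
  IsImaginaryQuadratic K → SatisfiesHeegnerHypothesis (W.conductorNorm ℤ) K →
  ∃ (Dt : ModularParametrizationData W (W.conductorNorm ℤ)) (β : ℤ) (ι : K →+* ℂ) (n : ℕ)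
    (d : KolyvaginHeegnerData Dt β ι n),
    KolyvaginDescent.KolSupp (Zhang2014.IsKolyvaginPrime (W.conductorNorm ℤ) W K p) n ∧
      (1 : ℕ∞) ≤ Zhang2014.levelIndex W p n ∧ d.kolyvaginClass hp.out 1 ≠ 0

/-- **SZ14♯ implies the SZ14-shaped statement with the 𝓛-clause deleted** (bookkeeping only): under SZ14's binders (c)
«`p ∤ v_p(Δ_min)`» and ♠(2) «every multiplicative `ℓ ≠ p` has `p ∤ v_ℓ(Δ_min)`» one has `p ∤ ∏ c_ℓ` PROVIDED this is
supplied (`htam`; on `p ≥ 5` it follows from (c) + ♠(2) since additive Tamagawa numbers are `≤ 4 < p` and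
`c_ℓ ∣ v_ℓ(Δ_min)` or `c_ℓ ≤ 2` at multiplicative `ℓ` — a numerical fact we do not formalise here, hence the explicit
binder). Nothing asserted about either statement. [folklore] -/
theorem skinnerZhangFlatShape_of_sharp (W : WeierstrassCurve ℚ) [W.IsElliptic] [W.IsGloballyMinimal]
    [NeZero (W.conductorNorm ℤ)] (p : ℕ) [hp : Fact p.Prime] (K : Type) [Field K] [NumberField K]
    (h : SkinnerZhangSharp W p K) (htam : ¬ p ∣ W.tamagawaProduct) :
    5 ≤ p → W.HasMultiplicativeReductionAtPrime p →
    W.HasIrreducibleModPGaloisRep p →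
    ¬ p ∣ padicValInt p W.minimalDiscriminantInt →
    (∀ (ℓ : ℕ) [Fact ℓ.Prime], ℓ ≠ p → W.HasMultiplicativeReductionAtPrime ℓ →
      ¬ p ∣ padicValInt ℓ W.minimalDiscriminantInt) →
    (∃ (ℓ : ℕ) (_ : Fact ℓ.Prime), ℓ ≠ p ∧ W.HasMultiplicativeReductionAtPrime ℓ ∧
      ¬ p ∣ padicValInt ℓ W.minimalDiscriminantInt) →
    IsImaginaryQuadratic K → SatisfiesHeegnerHypothesis (W.conductorNorm ℤ) K →
    ∃ (Dt : ModularParametrizationData W (W.conductorNorm ℤ)) (β : ℤ) (ι : K →+* ℂ) (n : ℕ)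
      (d : KolyvaginHeegnerData Dt β ι n),
      KolyvaginDescent.KolSupp (Zhang2014.IsKolyvaginPrime (W.conductorNorm ℤ) W K p) n ∧
        (1 : ℕ∞) ≤ Zhang2014.levelIndex W p n ∧ d.kolyvaginClass hp.out 1 ≠ 0 :=
  fun hp5 hmult hirr _ _ hRam hK hH ↦ h hp5 hmult hirr hRam htam hK hH

/-- **SZ14♯ ⇒ STEP L at `p ≥ 5` on the whole Locus**: the McCallum consumer
(`Koly.indexLowerBoundAt_of_kolyvaginClass_one_ne_zero_of_mccallum`, any odd `p`). CONDITIONAL on `hMc`;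
`hSZs : SkinnerZhangSharp W p K` is a HYPOTHESIS (open; memo not yet refereed).
[cite: McCallumLMS1991, §5 Cor. 5.6 (p. 310)] -/
theorem exists_indexLowerBoundAt_of_skinnerZhangSharp_of_mccallum (W : WeierstrassCurve ℚ)
    [W.IsElliptic] [W.IsGloballyMinimal] [NeZero (W.conductorNorm ℤ)] (K : Type) [Field K]
    [NumberField K] (p : ℕ) [hp : Fact p.Prime] (hSZs : SkinnerZhangSharp W p K)
    (hMc : McCallum1991_pow_dvd_card_sha_primary_of_certificate)
    (hp5 : 5 ≤ p) (hmult : W.HasMultiplicativeReductionAtPrime p)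
    (hirr : W.HasIrreducibleModPGaloisRep p)
    (hRam : ∃ (ℓ : ℕ) (_ : Fact ℓ.Prime), ℓ ≠ p ∧ W.HasMultiplicativeReductionAtPrime ℓ ∧
      ¬ p ∣ padicValInt ℓ W.minimalDiscriminantInt)
    (htam : ¬ p ∣ W.tamagawaProduct)
    (hK : IsImaginaryQuadratic K) (hH : SatisfiesHeegnerHypothesis (W.conductorNorm ℤ) K)
    (hCM : ¬ W.HasCM) (h3 : NumberField.discr K ≠ -3) (h4 : NumberField.discr K ≠ -4)
    (hsurj : ∀ m : ℕ, W.HasSurjectiveModNGaloisRep (p ^ m : ℕ))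
    (hrank : (W.baseChange K).mordellWeilRank = 1)
    (hiv : ∀ x : (W.baseChange K).toAffine.Point, p • x = 0 → x = 0)
    [Finite (W.baseChange K).sha] :
    ∃ (Dt : ModularParametrizationData W (W.conductorNorm ℤ)) (β : ℤ) (ι : K →+* ℂ),
      ∀ (d₁ : KolyvaginHeegnerData Dt β ι 1) (P : (W.baseChange K).toAffine.Point),
        d₁.toGeomPoints d₁.derivedPoint = toGeomPoints (W.baseChange K) P →
        ¬ IsOfFinAddOrder P →
        ∀ (M₀ : ℕ), (∃ Q : (W.baseChange K).toAffine.Point, ((p ^ M₀ : ℕ) : ℤ) • Q = P) →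
          (¬ ∃ Q : (W.baseChange K).toAffine.Point, ((p ^ (M₀ + 1) : ℕ) : ℤ) • Q = P) →
          IndexLowerBoundAt W p K P := by
  obtain ⟨Dt, β, ι, n, d, hn, -, hne⟩ := hSZs hp5 hmult hirr hRam htam hK hH
  have hp2 : p ≠ 2 := by omega
  exact ⟨Dt, β, ι, fun d₁ P hP hPinf M₀ hdiv hndiv ↦
    indexLowerBoundAt_of_kolyvaginClass_one_ne_zero_of_mccallum W K hMc hCM hK h3 h4 hH p hp2 hsurj
      Dt β ι d₁ P hP hPinf hrank hiv hdiv hndiv d hn hne⟩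

end Summit.BirchSwinnertonDyer.Rank1Residual.X11b.Three.Koly

end
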